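import Literature.NumberTheory.EllipticCurves.NeronComponentIndexTypeI0starProofs
import Summits.BirchSwinnertonDyer.BirchSwinnertonDyer.Theorems.Rank2ObservatoryTamagawaIstarLocal
import HarnessLib

/-!
# BSD rank ≥ 2 observatory (`b2b-bsdr2`, cert-2 gen 11): the EXACT local Tamagawa number for the
# Kodaira type `I₀*` — `c = 1 + #{roots of Tate's cubic in the residue field}`

HONEST FRAMING: per-curve certified theorems and census instruments; no claim on BSD in rank ≥ 2.

Theorems only (no named fact, no axiom).  Over a Henselian DVR `R` (fraction field `K`) let `J` be
in the normal form of Tate's Step 6: `a₁ = πα`, `a₂ = πβ`, `a₃ = π²γ`, `a₄ = π²δ`, `a₆ = π³ε` with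
the cubic `P(T) = T³ + β̄T² + δ̄T + ε̄` SEPARABLE (type `I₀*` when minimal).  The tree proves
`[E(K) : E₀(K)] ∈ {1, 2, 4}` (`LocalIndex.index_mem_of_normalForm_Istar_zero`: the root map
`E(K)/E₀(K) ↪ {0} ⊔ {roots of P̄}` is injective).  This file proves it is a BIJECTION, i.e. Tate's
exact rule `c = 1 + #{r ∈ k : P̄(r) = 0}` (Silverman *ATAEC* IV.9.4 Step 6):
* surjectivity — every residue root `r` of the separable cubic Hensel-lifts to a root `t ∈ R` of
  `T³ + βT² + δT + ε`, and `(πt, 0)` is then an `R`-point with singular reduction over `r`;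
* injectivity — two bad points over DIFFERENT roots are incongruent modulo `E₀(K)`: their difference
  has singular reduction (`not_hasNonsingularReduction_add_of_residue_ne`, part 1 of the `Iₙ*` files),
  and over the same root they are congruent (tree, `LocalIndex.hasNonsingularReduction_add_of_same_root`);
* `index_Istar_zero_eq_card_add_one`: `[E(K) : E₀(K)] = #S + 1` for any finset `S` of the residue
  field that is exactly the root set of `P̄`;
* `index_Istar_zero_intCast_eq`: the same on an integer model cast along `p = πε` — the count is the
  number of `w < p` with `p ∣ w³ + (a₂/p)w² + (a₄/p²)w + a₆/p³`, for any Boolean test agreeing with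
  that divisibility (the certificate's `pdvd`).
References: [Tate1975] J. Tate, LNM 476 (1975) §7 (case 6); [Silverman1994] [SilvermanATAEC1994]
J. H. Silverman, GTM 151 (1994), IV.9.4 Step 6 and Table 4.1.
-/

set_option linter.dupNamespace false
set_option autoImplicit false

noncomputable section

open scoped Classical

open Polynomial IsLocalRing WeierstrassCurve
  Literature.NumberTheory.EllipticCurves Literature.NumberTheory.EllipticCurves.LocalIndex
  Literature.NumberTheory.DiophantineGeometry Literature.NumberTheory.DiophantineGeometry.TateAlgorithm

namespace Summit.BirchSwinnertonDyer.BirchSwinnertonDyer.Rank2Observatory.Tam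

section Local

variable {R : Type*} [CommRing R] [IsDomain R] [IsDiscreteValuationRing R]
  {K : Type*} [Field K] [Algebra R K] [IsFractionRing R K]

/-- Hensel: a SIMPLE residue root of `T³ + β̄T² + δ̄T + ε̄` lifts to a root in `R`. [cite: Tate1975, §7] -/
theorem exists_root_cubic_of_residue_root [HenselianLocalRing R] {β δ ε : R} (r : ResidueField R)
    (hr : r ^ 3 + residue R β * r ^ 2 + residue R δ * r + residue R ε = 0)
    (hr' : 3 * r ^ 2 + 2 * residue R β * r + residue R δ ≠ 0) :
    ∃ t : R, t ^ 3 + β * t ^ 2 + δ * t + ε = 0 ∧ residue R t = r := by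
  obtain ⟨t₀, rfl⟩ := IsLocalRing.residue_surjective r
  set g : R[X] := X ^ 3 + C β * X ^ 2 + C δ * X + C ε with hg
  have hmonic : g.Monic := by rw [hg]; monicity!
  have hev : ∀ x, g.eval x = x ^ 3 + β * x ^ 2 + δ * x + ε := by intro x; simp [hg]
  have hev' : ∀ x, g.derivative.eval x = 3 * x ^ 2 + 2 * β * x + δ := by
    intro x; simp [hg]; ring
  have h₁ : g.eval t₀ ∈ maximalIdeal R := by
    rw [hev, ← residue_eq_zero_iff]; simpa [map_add, map_mul, map_pow] using hr
  have h₂ : IsUnit (g.derivative.eval t₀) := by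
    rw [hev', isUnit_iff_residue_ne_zero]; simpa [map_add, map_mul, map_pow, map_ofNat] using hr'
  obtain ⟨t, ht, ht₀⟩ := HenselianLocalRing.is_henselian g hmonic t₀ h₁ h₂
  refine ⟨t, by rw [← hev]; exact ht, ?_⟩
  have := (residue_eq_zero_iff _).mpr ht₀
  rwa [map_sub, sub_eq_zero] at this

/-- **`[E(K) : E₀(K)] = 1 + #{roots of P̄}` for the normal form of type `I₀*`** (`R` Henselian,
`Δ ≠ 0`, separable cubic): the root map from `E(K)/E₀(K)` to `{0} ⊔ {r : P̄(r) = 0}` is a bijection.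
[cite: Tate1975, §7] [cite: Silverman1994, IV.9.4 Step 6] -/
theorem index_Istar_zero_eq_card_add_one [HenselianLocalRing R] (J : WeierstrassCurve R)
    {ϖ α β γ δ ε : R} (hϖ : Irreducible ϖ) (hα : J.a₁ = ϖ * α) (hβ : J.a₂ = ϖ * β)
    (hγ : J.a₃ = ϖ ^ 2 * γ) (hδ : J.a₄ = ϖ ^ 2 * δ) (hε : J.a₆ = ϖ ^ 3 * ε) (hΔ : J.Δ ≠ 0)
    (hdisc : residue R β ^ 2 * residue R δ ^ 2 - 4 * residue R δ ^ 3 -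
      4 * residue R β ^ 3 * residue R ε - 27 * residue R ε ^ 2 +
      18 * residue R β * residue R δ * residue R ε ≠ 0)
    (S : Finset (ResidueField R))
    (hS : ∀ r, r ∈ S ↔ r ^ 3 + residue R β * r ^ 2 + residue R δ * r + residue R ε = 0) :
    (J.nonsingularReductionSubgroup (integers_valuationRing_valuation R K)).index = S.card + 1 := by
  set H := J.nonsingularReductionSubgroup (integers_valuationRing_valuation R K) with hH
  have hinj := IsFractionRing.injective R K
  set f := algebraMap R K with hf
  have hm : ϖ ∈ maximalIdeal R := (IsLocalRing.mem_maximalIdeal _).mpr hϖ.not_isUnit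
  have hres0 : residue R ϖ = 0 := (residue_eq_zero_iff _).mpr hm
  have h2 : J.a₂ ∈ maximalIdeal R := hβ ▸ Ideal.mul_mem_right _ _ hm
  have h3 : J.a₃ ∈ maximalIdeal R :=
    hγ ▸ Ideal.mul_mem_right _ _ (Ideal.pow_mem_of_mem _ hm 2 two_pos)
  have h4 : J.a₄ ∈ maximalIdeal R :=
    hδ ▸ Ideal.mul_mem_right _ _ (Ideal.pow_mem_of_mem _ hm 2 two_pos)
  have h6 : J.a₆ ∈ maximalIdeal R :=
    hε ▸ Ideal.mul_mem_right _ _ (Ideal.pow_mem_of_mem _ hm 3 three_pos)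
  have hsimple : ∀ r : ResidueField R,
      r ^ 3 + residue R β * r ^ 2 + residue R δ * r + residue R ε = 0 →
        3 * r ^ 2 + 2 * residue R β * r + residue R δ ≠ 0 :=
    fun r hr hr' => hdisc (cubicDiscr_eq_zero_of_double_root hr hr')
  have hΔK : (J.baseChange K).Δ ≠ 0 := by
    rw [WeierstrassCurve.baseChange, WeierstrassCurve.map_Δ]; exact (map_ne_zero_iff _ hinj).mpr hΔ
  -- Hensel lifts of the roots and the points `(πt, 0)` over them
  have hlift : ∀ r : ResidueField R, r ∈ S →
      ∃ t : R, t ^ 3 + β * t ^ 2 + δ * t + ε = 0 ∧ residue R t = r :=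
    fun r hr => exists_root_cubic_of_residue_root r ((hS r).mp hr) (hsimple r ((hS r).mp hr))
  choose! tr htr htres using hlift
  have hns : ∀ r : ResidueField R, r ∈ S →
      (J.baseChange K).toAffine.Nonsingular (f (ϖ * tr r)) (f (ϖ ^ 2 * 0)) := fun r hr =>
    (WeierstrassCurve.Affine.equation_iff_nonsingular_of_Δ_ne_zero hΔK).mp
      ((WeierstrassCurve.Affine.map_equation _ hinj (ϖ * tr r) (ϖ ^ 2 * 0)).mpr (by
        rw [WeierstrassCurve.Affine.equation_iff, hβ, hδ, hε]
        linear_combination (-(ϖ ^ 3)) * htr r hr))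
  have hbad : ∀ r (hr : r ∈ S), ¬ J.HasNonsingularReduction (.some _ _ (hns r hr)) := fun r hr =>
    not_hasNonsingularReduction_some J h3 h4 (Ideal.mul_mem_right _ _ hm)
      (Ideal.mul_mem_right _ _ (Ideal.pow_mem_of_mem _ hm 2 two_pos)) (hns r hr)
  -- negatives of points `(πx₁, π²y₂)`
  have hneg : ∀ x₁ y₂ : R, (J.baseChange K).toAffine.negY (f (ϖ * x₁)) (f (ϖ ^ 2 * y₂)) =
      f (ϖ ^ 2 * (-y₂ - α * x₁ - γ)) := by
    intro x₁ y₂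
    rw [WeierstrassCurve.Affine.negY]
    simp only [hf, WeierstrassCurve.baseChange, WeierstrassCurve.map_a₁, WeierstrassCurve.map_a₃,
      hα, hγ, map_neg, map_sub, map_mul, map_pow]
    ring
  have hnsneg : ∀ {x₁ y₂ : R}, (J.baseChange K).toAffine.Nonsingular (f (ϖ * x₁)) (f (ϖ ^ 2 * y₂)) →
      (J.baseChange K).toAffine.Nonsingular (f (ϖ * x₁)) (f (ϖ ^ 2 * (-y₂ - α * x₁ - γ))) :=
    fun {x₁ y₂} h => hneg x₁ y₂ ▸ (WeierstrassCurve.Affine.nonsingular_neg _ _).mpr h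
  have hnegpt : ∀ {x₁ y₂ : R}
      (h : (J.baseChange K).toAffine.Nonsingular (f (ϖ * x₁)) (f (ϖ ^ 2 * y₂))),
      -(WeierstrassCurve.Affine.Point.some _ _ h) = .some _ _ (hnsneg h) := by
    intro x₁ y₂ h
    rw [WeierstrassCurve.Affine.Point.neg_some]
    exact point_some_congr rfl (hneg x₁ y₂)
  -- the root map as a bijection `Option S ≃ E(K)/E₀(K)`
  set Q := (J.baseChange K).toAffine.Point ⧸ H with hQ
  let G : Option S → Q := fun o => o.elim 0 fun r =>
    (QuotientAddGroup.mk (WeierstrassCurve.Affine.Point.some _ _ (hns r.1 r.2)) : Q)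
  have hGinj : Function.Injective G := by
    rintro (_ | ⟨r, hr⟩) (_ | ⟨r', hr'⟩) h
    · rfl
    · exact absurd ((WeierstrassCurve.mem_nonsingularReductionSubgroup_iff _).mp
        ((QuotientAddGroup.eq_zero_iff _).mp h.symm)) (hbad r' hr')
    · exact absurd ((WeierstrassCurve.mem_nonsingularReductionSubgroup_iff _).mp
        ((QuotientAddGroup.eq_zero_iff _).mp h)) (hbad r hr)
    · simp only [G, Option.elim] at h
      rw [QuotientAddGroup.eq_iff_sub_mem, sub_eq_add_neg, hnegpt] at h
      by_contra hne
      have hne' : residue R (tr r) ≠ residue R (tr r') := by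
        rw [htres r hr, htres r' hr']
        exact fun e => hne (by subst e; rfl)
      exact not_hasNonsingularReduction_add_of_residue_ne J hϖ h2 h3 h4 h6 hne' (hns r hr)
        (hnsneg (hns r' hr')) ((WeierstrassCurve.mem_nonsingularReductionSubgroup_iff _).mp h)
  have hGsurj : Function.Surjective G := by
    intro q
    induction q using QuotientAddGroup.induction_on with
    | H P =>
      by_cases hP : J.HasNonsingularReduction P
      · exact ⟨none, ((QuotientAddGroup.eq_zero_iff _).mpr
          ((WeierstrassCurve.mem_nonsingularReductionSubgroup_iff _).mpr hP)).symm⟩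
      · obtain ⟨x₁, y₂, h, rfl, hid⟩ :=
          exists_root_of_not_hasNonsingularReduction J hϖ hα hβ hγ hδ hε hP
        have hr : residue R x₁ ∈ S := (hS _).mpr (by
          have := congrArg (residue R) hid
          simpa [hres0] using this)
        refine ⟨some ⟨residue R x₁, hr⟩, ?_⟩
        simp only [G, Option.elim]
        rw [QuotientAddGroup.eq_iff_sub_mem, sub_eq_add_neg, hnegpt]
        exact (WeierstrassCurve.mem_nonsingularReductionSubgroup_iff _).mpr
          (hasNonsingularReduction_add_of_same_root J hϖ hα hβ hγ hδ hε (htres _ hr)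
            (by rw [htres _ hr]; exact hsimple _ ((hS _).mp hr)) (hns _ hr) (hnsneg h))
  have hcard := Nat.card_congr (Equiv.ofBijective G ⟨hGinj, hGsurj⟩)
  rw [AddSubgroup.index_eq_card, ← hcard, Nat.card_eq_fintype_card, Fintype.card_option,
    Fintype.card_coe]

end Local

/-! ### The same count on an integer equation cast into `R` along `p = ϖ ε` -/

section IntCast

open Tate

variable {R : Type*} [CommRing R] [IsDomain R] [IsDiscreteValuationRing R]
  {K : Type*} [Field K] [Algebra R K] [IsFractionRing R K] {p : ℕ} {ε : R}

/-- The value of Tate's cubic with coefficients `ε̄Ā₂, ε̄²Ā₄, ε̄³Ā₆` at `ε̄ w̄` is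
`ε̄³ (w³ + A₂w² + A₄w + A₆)‾`.
[folklore] -/
theorem cubic_residue_intCast (A₂ A₄ A₆ w : ℤ) :
    (residue R (w : R) * residue R ε) ^ 3 + residue R (ε ^ 1 * ((A₂ : ℤ) : R)) *
        (residue R (w : R) * residue R ε) ^ 2 + residue R (ε ^ 2 * ((A₄ : ℤ) : R)) *
        (residue R (w : R) * residue R ε) + residue R (ε ^ 3 * ((A₆ : ℤ) : R)) =
      residue R ε ^ 3 * residue R (((w ^ 3 + A₂ * w ^ 2 + A₄ * w + A₆ : ℤ)) : R) := by
  push_cast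
  simp only [map_add, map_mul, map_pow, map_intCast]
  ring

/-- An integer multiple of `p` has residue `0`. [folklore] -/
theorem residue_intCast_eq_zero (hpε : (p : R) = uniformizer R * ε) {d : ℤ} (h : (p : ℤ) ∣ d) :
    residue R ((d : ℤ) : R) = 0 :=
  (residue_eq_zero_iff _).mpr (mem_maximalIdeal_iff_dvd.mpr
    (uniformizer_dvd_intCast hpε (by simpa only [pow_one] using h)))

/-- **`I₀*` on an integer equation: `[E(K) : E₀(K)] = 1 + #{w < p : p ∣ w³ + (a₂/p)w² + (a₄/p²)w + a₆/p³}`**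
(`R` Henselian): `p ∣ a₁, a₂`, `p² ∣ a₃, a₄`, `p³ ∣ a₆`, `p ∤ disc3 (a₂/p) (a₄/p²) (a₆/p³)`,
`pⁿ ∥ Δ`, every residue class represented by an integer `< p` (true for `ℤ_p`), and `P` any Boolean
test of `w` agreeing with the divisibility. [cite: Tate1975, §7] [cite: Silverman1994, IV.9.4 Step 6] -/
theorem index_Istar_zero_intCast_eq [HenselianLocalRing R] (hp : p.Prime) (hε : IsUnit ε)
    (hpε : (p : R) = uniformizer R * ε) {M : WeierstrassCurve ℤ} (h1 : (p : ℤ) ^ 1 ∣ M.a₁)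
    (h2 : (p : ℤ) ^ 1 ∣ M.a₂) (h3 : (p : ℤ) ^ 2 ∣ M.a₃) (h4 : (p : ℤ) ^ 2 ∣ M.a₄)
    (h6 : (p : ℤ) ^ 3 ∣ M.a₆)
    (hd : ¬ (p : ℤ) ∣ disc3 (M.a₂ / (p : ℤ) ^ 1) (M.a₄ / (p : ℤ) ^ 2) (M.a₆ / (p : ℤ) ^ 3))
    {n : ℕ} (hΔ : (p : ℤ) ^ n ∣ M.Δ) (hΔ' : ¬ (p : ℤ) ^ (n + 1) ∣ M.Δ)
    (hsurj : ∀ y : ResidueField R, ∃ k : ℕ, k < p ∧ residue R ((k : ℤ) : R) = y)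
    (P : ℕ → Bool) (hP : ∀ w : ℕ, P w = true ↔ (p : ℤ) ∣ (w : ℤ) ^ 3 +
      M.a₂ / (p : ℤ) ^ 1 * (w : ℤ) ^ 2 + M.a₄ / (p : ℤ) ^ 2 * w + M.a₆ / (p : ℤ) ^ 3) :
    ((M.map (Int.castRingHom R)).nonsingularReductionSubgroup
      (integers_valuationRing_valuation R K)).index = ((List.range p).filter P).length + 1 := by
  obtain ⟨e1, e2, e3, e4, e6, eΔ⟩ := map_intCast_eqs (R := R) M
  have hē : residue R ε ≠ 0 := residue_ne_zero_of_isUnit hε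
  set A₂ : ℤ := M.a₂ / (p : ℤ) ^ 1 with hA₂
  set A₄ : ℤ := M.a₄ / (p : ℤ) ^ 2 with hA₄
  set A₆ : ℤ := M.a₆ / (p : ℤ) ^ 3 with hA₆
  set L := (List.range p).filter P with hL
  have hLnodup : L.Nodup := List.nodup_range.filter _
  have hmemL : ∀ w, w ∈ L ↔ w < p ∧ (p : ℤ) ∣ (w : ℤ) ^ 3 + A₂ * (w : ℤ) ^ 2 + A₄ * w + A₆ := by
    intro w; rw [hL, List.mem_filter, List.mem_range, hP]
  set S : Finset (ResidueField R) :=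
    L.toFinset.image (fun w : ℕ => residue R ((w : ℤ) : R) * residue R ε) with hSdef
  have hcard : S.card = L.length := by
    rw [hSdef, Finset.card_image_of_injOn, List.toFinset_card_of_nodup hLnodup]
    intro w hw w' hw' h
    have hwp : w < p := ((hmemL w).mp (List.mem_toFinset.mp hw)).1
    have hwp' : w' < p := ((hmemL w').mp (List.mem_toFinset.mp hw')).1
    have h' : residue R ((w : ℤ) : R) = residue R ((w' : ℤ) : R) := mul_right_cancel₀ hē h
    have hdvd : (p : ℤ) ∣ (w : ℤ) - (w' : ℤ) := by
      by_contra hnd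
      refine residue_intCast_ne_zero hp hpε hnd ?_
      rw [Int.cast_sub, map_sub, h', sub_self]
    have h0 := Int.eq_zero_of_abs_lt_dvd hdvd (abs_sub_lt_iff.mpr ⟨by omega, by omega⟩)
    omega
  have hS : ∀ r, r ∈ S ↔ r ^ 3 + residue R (ε ^ 1 * ((A₂ : ℤ) : R)) * r ^ 2 +
      residue R (ε ^ 2 * ((A₄ : ℤ) : R)) * r + residue R (ε ^ 3 * ((A₆ : ℤ) : R)) = 0 := by
    intro r
    constructor
    · intro hr
      obtain ⟨w, hw, rfl⟩ := Finset.mem_image.mp hr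
      rw [cubic_residue_intCast,
        residue_intCast_eq_zero hpε ((hmemL w).mp (List.mem_toFinset.mp hw)).2, mul_zero]
    · intro hr
      obtain ⟨w, hwp, hw⟩ := hsurj (r * (residue R ε)⁻¹)
      have hr' : r = residue R ((w : ℤ) : R) * residue R ε := by
        rw [hw, inv_mul_cancel_right₀ hē]
      rw [hr', cubic_residue_intCast] at hr
      have hdvd : (p : ℤ) ∣ (w : ℤ) ^ 3 + A₂ * (w : ℤ) ^ 2 + A₄ * w + A₆ := by
        by_contra hnd
        exact residue_intCast_ne_zero hp hpε hnd
          ((mul_eq_zero.mp hr).resolve_left (pow_ne_zero 3 hē))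
      exact Finset.mem_image.mpr ⟨w, List.mem_toFinset.mpr ((hmemL w).mpr ⟨hwp, hdvd⟩), hr'.symm⟩
  rw [← hcard]
  refine index_Istar_zero_eq_card_add_one (K := K) _ irreducible_uniformizer
    (α := ε ^ 1 * ((M.a₁ / (p : ℤ) ^ 1 : ℤ) : R)) (β := ε ^ 1 * ((A₂ : ℤ) : R))
    (γ := ε ^ 2 * ((M.a₃ / (p : ℤ) ^ 2 : ℤ) : R)) (δ := ε ^ 2 * ((A₄ : ℤ) : R))
    (ε := ε ^ 3 * ((A₆ : ℤ) : R))
    (by rw [e1, intCast_eq_of_pow_dvd hpε h1, pow_one])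
    (by rw [e2, intCast_eq_of_pow_dvd hpε h2, pow_one])
    (by rw [e3, intCast_eq_of_pow_dvd hpε h3]) (by rw [e4, intCast_eq_of_pow_dvd hpε h4])
    (by rw [e6, intCast_eq_of_pow_dvd hpε h6]) ?_ ?_ S hS
  · rw [eΔ]; exact fun h0 => not_pow_succ_dvd_intCast hp hε hpε hΔ hΔ' (h0 ▸ dvd_zero _)
  · have key : ∀ (e P Q W : ResidueField R),
        (e * P) ^ 2 * (e ^ 2 * Q) ^ 2 - 4 * (e ^ 2 * Q) ^ 3 - 4 * (e * P) ^ 3 * (e ^ 3 * W) -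
          27 * (e ^ 3 * W) ^ 2 + 18 * (e * P) * (e ^ 2 * Q) * (e ^ 3 * W) =
        e ^ 6 * (P ^ 2 * Q ^ 2 - 4 * Q ^ 3 - 4 * P ^ 3 * W - 27 * W ^ 2 + 18 * P * Q * W) := by
      intro e P Q W; ring
    simp only [map_mul, map_pow, pow_one]
    rw [key]
    refine mul_ne_zero (pow_ne_zero 6 hē) ?_
    have := residue_intCast_ne_zero hp hpε hd
    simpa only [disc3, Int.cast_add, Int.cast_sub, Int.cast_mul, Int.cast_pow, Int.cast_ofNat,
      map_add, map_sub, map_mul, map_pow, map_ofNat, map_intCast] using this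

end IntCast

end Summit.BirchSwinnertonDyer.BirchSwinnertonDyer.Rank2Observatory.Tam

end
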